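import Summits.KontsevichZagierPeriods.KontsevichZagierPeriods.Theses.StandardParts
import Literature.NumberTheory.Transcendental.KZTameMoveFamily
import Literature.NumberTheory.Transcendental.KZTameCert

/-!
# `SpVolumeArcLifting` (stmt-KontsevichZagierPeriods-18034, route StandardParts) — BIRTH SKELETON

Piece X₁ of the crux-strategist's BC2-redirect split of the deciding crux `SpArcLifting` (stmt-3155):
**VOLUME ARC LIFTING** — two compact top-dimensional `ℚ`-semialgebraic bodies `K, K' ⊆ ℝᵈ` of equal
volume (integral representations with integrand `1`) are the `L¹`-endpoints, as `t → 0⁺`, of two TAME raw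
`ℚ`-semialgebraic families `S, S' : KZ.RawFamily d` forming an ARC OF IDENTITIES (at every rational
`q ∈ (0,1)` all integral representations realising the fibres are `KZ.Equivalent`).

The crux (FIXED, never restated here):
`Summit.KontsevichZagierPeriods.KontsevichZagierPeriods.Theses.StandardParts.SpVolumeArcLifting`.
It is the ARITHMETIC HALF of the split (summit-implied by cut-off constant arcs; flagged summit-half):
any engine for it must MANUFACTURE arcs of identities that genuinely move. This line is the one engine
the tree already has vocabulary for — INEQUALITY CERTIFICATES OF BOUNDED COST (route InequalityCost).

## The line: bounded-cost ε-certificates in the ambient dimension → uniform arcs → identities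

* `stub_boundedCostAmbient` (open-problem; the hardest — it is InequalityCost's thesis BoundedCost,
  item 11056, in the variant where the non-negative slack `P` lives in the AMBIENT dimension, as in
  FinitePacking, item 8994): for compact bodies `K, K' ⊆ ℝⁿ⁺¹` of equal volume there is ONE size `N`
  such that for every rational `ε ∈ (0,1)` the one-sided identity
  `[K] + [box_ε] − [K'] − [P_ε] = Σ_{i<N} mᵢ` holds in the free abelian group on raw real pairs with
  `P_ε ≥ 0` tame and every `mᵢ` a (signed) COMPLEXITY-BOUNDED tame move (`KZ.tameMoves N` of
  `KZTameCert.lean`; `box_ε = [0,ε] × [0,1]ⁿ`). "Inequality proofs never get harder."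
* `stub_uniformArcsOfBoundedCost` (L): bounded cost ⇒ UNIFORM TAME ARCS: the level sets
  `{ε | a size-N certificate of a fixed template exists}` are first-order hence `ℚ`-semialgebraic, their
  union contains `ℚ ∩ (0,1)` so one template covers some `(0,δ)`; definable choice (van den Dries Ch. 6
  (1.2); InequalityCost.DefinableChoice 8993) makes the data `ℚ`-semialgebraic in `t`; rescale `(0,δ)` to
  `(0,1)`; then `S_t := K ⊔ box_t` (disjoint rational translate) and `S'_t := K' ⊔ P_t` are `N'`-tame raw
  families whose difference of generators is ONE tame uniform chain over `(0,1)` (the certificate family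
  plus two domain-additivity families splitting the disjoint unions), with `S_t → K` in `L¹` (the box has
  mass `t`) and `S'_t → K'` (soundness of the tame moves, `KZ.rawEval_eq_zero_of_mem_tameMoves`, gives
  `∫ P_t = vol K + t − vol K' = t → 0`, and `P_t ≥ 0`). In dimension `0` the bodies coincide and constant
  cut-off arcs do.
* `stub_identitiesOfTameUniformChain` (M, provable now; shared with the summit-implication of piece X₃):
  a tame uniform chain over `(0,1)` IS an arc of identities: at a rational `q` every tame raw pair
  occurring is realised by an integral representation (bounded `ℚ`-semialgebraic data — the move
  families are `ℚ`-semialgebraic TOTAL objects, so their fibres at rational `q` are `ℚ`-semialgebraic,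
  `RawFamily.isSemialgebraic_fibre`), each raw move-family instance at `q` is a KZ move among the
  realisations (`RawDomainAddFamilyOn.mem_domainAddRel`, `RawIntegrandAddFamilyOn.mem_integrandAddRel`,
  `RawCovFamilyOn.mem_changeOfVariablesRel`, `RawNLFamilyOn.mem_newtonLeibnizRel`), and the identity in
  the free abelian group on raw pairs maps to `KZ.FormalRep` under "realise" (a homomorphism defined
  generator-wise by choice), giving `[ρ] − [ρ'] ∈ KZ.relations`.

Assembly `SpVolumeArcLifting_of` = `stub_uniformArcsOfBoundedCost stub_boundedCostAmbient` for the arcs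
and `stub_identitiesOfTameUniformChain` for the identities (kernel-checked; `sorry` only inside `stub_*`).

Disproof used: none relevant (no `Disproof.lean` / Negative lemma for 18034 or 3155; `ledger negatives`:
1 entry, KinematicPlaneConvex, unrelated). Dead lines avoided (lead c1, LeadReportC1.md finding 4):
interpolating arcs `r ⊔ B_t` need value-zero classes realised with arbitrarily small `L¹`-mass — here
the small-mass carriers ARE supplied, by the certificates (`box_t`, `P_t` of mass `t`); transported arcs
`Φ_t(S_t)` (one change of variables cannot reach a transcendental target density) are not used.

References: Kontsevich–Zagier 2001 §1.2 [KontsevichZagier2001]; Viu-Sos 2021 §4 Lemmas 4.1–4.3, Rem. 4.1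
[ViuSos2021]; Cresson–Viu-Sos 2022 §1 p. 326 [CressonViusos2022]; van den Dries 1998 Ch. 6 (1.2)
[Dries1998]; Basu–Pollack–Roy 2006 §2.3 [BasuPollackRoy2006].
-/

noncomputable section

open Set MeasureTheory Filter
open scoped Topology BigOperators
open Literature.NumberTheory.Transcendental
open Literature.ModelTheory.ExponentialFields (IsSemialgebraic)
open Summit.KontsevichZagierPeriods.KontsevichZagierPeriods.Theses.StandardParts (SpVolumeArcLifting)

namespace Summit.KontsevichZagierPeriods.KontsevichZagierPeriods.Cruxes.SpVolumeArcLifting.Birth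

/-! ## Stubs of the line -/

/-- STUB `stub_boundedCostAmbient` (open-problem; the hardest). **Bounded cost with ambient-dimension
slack** (InequalityCost.BoundedCost, item 11056, with the slack `P` kept in the ambient dimension as in
FinitePacking, item 8994): for compact top-dimensional bodies `K, K' ⊆ ℝⁿ⁺¹` of equal volume there is
`N` such that for EVERY rational `ε ∈ (0,1)` there are a representation `P` (domain in `[−N,N]ⁿ⁺¹`,
`0 ≤ integrand ≤ N`) and `N` terms `mᵢ ∈ ±KZ.tameMoves N ∪ {0}` with
`[K] + [box_ε] − [K'] − [P] = Σᵢ mᵢ` in the free abelian group on raw real pairs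
(`box_ε = [0,ε] × [0,1]ⁿ`; generators indicator-normalised, `KZ.volGen`, `KZ.rawGen`). Soundly such a
certificate proves `vol K − vol K' ≥ −ε`; the claim is that their SIZE stays bounded as `ε → 0⁺`.
Why plausibly true: for accessible pairs a bounded-size tame chain gives certificates of one size for
all `ε` (`KZ.exists_forall_tameCert_of_mem_closure`-type padding). Why it might fail: summit-strength and
a little more — growth of the cost `N_c(ε) → ∞` for ONE equal-volume pair is a disproof of tame
accessibility of that identity (route Neg's pair 0312). [cite: ViuSos2021, §4 Rem. 4.1]
[cite: KontsevichZagier2001, §1.2] [cite: BasuPollackRoy2006, §2.3] -/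
theorem stub_boundedCostAmbient :
    ∀ ⦃n : ℕ⦄ (K K' : KZ.IntegralRep (n + 1)), IsCompact K.domain → (interior K.domain).Nonempty →
      IsCompact K'.domain → (interior K'.domain).Nonempty → (∀ x ∈ K.domain, K.integrand x = 1) →
      (∀ x ∈ K'.domain, K'.integrand x = 1) → K.value = K'.value →
      ∃ N : ℕ, ∀ ε : ℚ, 0 < ε → ε < 1 →
        ∃ (P : KZ.IntegralRep (n + 1)) (m : Fin N → KZ.RawFormal),
          (∀ x ∈ P.domain, ∀ i, |x i| ≤ N) ∧ (∀ x ∈ P.domain, 0 ≤ P.integrand x ∧ P.integrand x ≤ N) ∧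
          (∀ i, m i ∈ KZ.tameMoves N ∨ -m i ∈ KZ.tameMoves N ∨ m i = 0) ∧
          KZ.volGen (n + 1) K.domain +
              KZ.volGen (n + 1) {x : Fin (n + 1) → ℝ | (0 ≤ x 0 ∧ x 0 ≤ (ε : ℝ)) ∧
                ∀ i, i ≠ 0 → 0 ≤ x i ∧ x i ≤ 1} -
              KZ.volGen (n + 1) K'.domain -
              KZ.rawGen (n + 1) P.domain (P.domain.indicator P.integrand) = ∑ i, m i := by
  sorry

/-- STUB `stub_uniformArcsOfBoundedCost` (L). **Bounded cost ⇒ uniform tame arcs.** If bounded-cost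
ambient certificates exist (the statement of `stub_boundedCostAmbient`), then every pair of compact
top-dimensional bodies `K, K' ⊆ ℝᵈ` of equal volume is the pair of `L¹`-endpoints of two `N`-tame raw
families `S, S'` whose difference of fibre generators is ONE tame uniform chain over `(0,1)`: first-order
level sets of the finitely many size-`N` templates are `ℚ`-semialgebraic (`tarski_seidenberg_real_holds`)
and jointly contain `ℚ ∩ (0,1)`, so one template covers some `(0,δ)`; definable choice
(InequalityCost.DefinableChoice, item 8993) selects `ℚ`-semialgebraic total data; rescale to `(0,1)`
(`RawMoveFamilyOn.rescale`); `S_t = K ⊔ box_t` (disjoint rational translate, mass `t → 0`) and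
`S'_t = K' ⊔ P_t` (`∫ P_t = t` by soundness `KZ.rawEval_eq_zero_of_mem_tameMoves`, `P_t ≥ 0`) converge in
`L¹` to `K`, `K'`; two extra domain-additivity families split the disjoint unions. Dimension `0`: the two
bodies are the point, constant cut-off arcs. Why it might fail: only bookkeeping (tameness bounds after
rescaling, `⌈N/δ⌉`). [cite: Dries1998, Ch. 6 (1.2)] [cite: KontsevichZagier2001, §1.2]
[cite: ViuSos2021, §4 Lemmas 4.1–4.3] -/
theorem stub_uniformArcsOfBoundedCost :
    (∀ ⦃n : ℕ⦄ (K K' : KZ.IntegralRep (n + 1)), IsCompact K.domain → (interior K.domain).Nonempty →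
      IsCompact K'.domain → (interior K'.domain).Nonempty → (∀ x ∈ K.domain, K.integrand x = 1) →
      (∀ x ∈ K'.domain, K'.integrand x = 1) → K.value = K'.value →
      ∃ N : ℕ, ∀ ε : ℚ, 0 < ε → ε < 1 →
        ∃ (P : KZ.IntegralRep (n + 1)) (m : Fin N → KZ.RawFormal),
          (∀ x ∈ P.domain, ∀ i, |x i| ≤ N) ∧ (∀ x ∈ P.domain, 0 ≤ P.integrand x ∧ P.integrand x ≤ N) ∧
          (∀ i, m i ∈ KZ.tameMoves N ∨ -m i ∈ KZ.tameMoves N ∨ m i = 0) ∧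
          KZ.volGen (n + 1) K.domain +
              KZ.volGen (n + 1) {x : Fin (n + 1) → ℝ | (0 ≤ x 0 ∧ x 0 ≤ (ε : ℝ)) ∧
                ∀ i, i ≠ 0 → 0 ≤ x i ∧ x i ≤ 1} -
              KZ.volGen (n + 1) K'.domain -
              KZ.rawGen (n + 1) P.domain (P.domain.indicator P.integrand) = ∑ i, m i) →
    ∀ ⦃d : ℕ⦄ (K K' : KZ.IntegralRep d), IsCompact K.domain → (interior K.domain).Nonempty →
      IsCompact K'.domain → (interior K'.domain).Nonempty → (∀ x ∈ K.domain, K.integrand x = 1) →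
      (∀ x ∈ K'.domain, K'.integrand x = 1) → K.value = K'.value →
      ∃ (N : ℕ) (S S' : KZ.RawFamily d), S.IsTame N ∧ S'.IsTame N ∧
        KZ.TameUniformChainOn N (Set.Ioo (0:ℝ) 1) (fun t => S.gen t - S'.gen t) ∧
        S.HasL1Limit K ∧ S'.HasL1Limit K' := by
  sorry

/-- STUB `stub_identitiesOfTameUniformChain` (M; provable now). **A tame uniform chain over `(0,1)` is an
arc of identities.** If `S`, `S'` are `N`-tame raw families and `t ↦ S.gen t − S'.gen t` is a tame uniform
chain over `(0,1)`, then at every rational `q ∈ (0,1)` all integral representations realising the two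
fibres are `KZ.Equivalent`: tame raw pairs at a rational parameter of `ℚ`-semialgebraic total families are
bounded `ℚ`-semialgebraic (`RawFamily.isSemialgebraic_fibre`, `isSemialgebraicFunOn_fibreFun`), hence
realised by integral representations; each move-family instance at `q` is a KZ move among realisations
(`RawDomainAddFamilyOn.mem_domainAddRel`, `RawIntegrandAddFamilyOn.mem_integrandAddRel`,
`RawCovFamilyOn.mem_changeOfVariablesRel`, `RawNLFamilyOn.mem_newtonLeibnizRel`); "realise" extends to a
homomorphism from the free abelian group on raw pairs to `KZ.FormalRep` (choice, generator-wise; `0` on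
non-realisable pairs, which do not occur), carrying the identity to `[ρ] − [ρ'] ∈ KZ.relations`; any two
realisations of one fibre are congruent (`KZ.of_sub_of_mem_relations_of_eqOn`). Why it might fail: it
does not (bookkeeping). [cite: KontsevichZagier2001, §1.2] [cite: BochnakCosteRoy1998, §2.2] -/
theorem stub_identitiesOfTameUniformChain :
    ∀ (N : ℕ) ⦃k k' : ℕ⦄ (S : KZ.RawFamily k) (S' : KZ.RawFamily k'), S.IsTame N → S'.IsTame N →
      KZ.TameUniformChainOn N (Set.Ioo (0:ℝ) 1) (fun t => S.gen t - S'.gen t) →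
      ∀ q : ℚ, (q : ℝ) ∈ Set.Ioo (0:ℝ) 1 → ∀ (ρ : KZ.IntegralRep k) (ρ' : KZ.IntegralRep k'),
        ρ.domain = S.fibre q → Set.EqOn ρ.integrand (S.fibreFun q) (S.fibre q) →
        ρ'.domain = S'.fibre q → Set.EqOn ρ'.integrand (S'.fibreFun q) (S'.fibre q) →
        KZ.Equivalent ρ ρ' := by
  sorry

/-! ## Assembly (kernel-checked; `sorry` only through the three declared stubs): concludes the crux BY NAME -/

/-- **ASSEMBLY `SpVolumeArcLifting_of`.** Bounded-cost ambient certificates (stub 1) give uniform tame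
arcs with the right `L¹`-endpoints (stub 2), and a tame uniform chain is an arc of identities (stub 3):
the crux `StandardParts.SpVolumeArcLifting` by name. [cite: KontsevichZagier2001, §1.2]
[cite: CressonViusos2022, §1 p. 326] -/
theorem SpVolumeArcLifting_of : SpVolumeArcLifting := by
  intro d K K' hc hi hc' hi' h1 h1' hv
  obtain ⟨N, S, S', hS, hS', huc, hl, hl'⟩ :=
    stub_uniformArcsOfBoundedCost stub_boundedCostAmbient K K' hc hi hc' hi' h1 h1' hv
  exact ⟨N, S, S', hS, hS', stub_identitiesOfTameUniformChain N S S' hS hS' huc, hl, hl'⟩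

end Summit.KontsevichZagierPeriods.KontsevichZagierPeriods.Cruxes.SpVolumeArcLifting.Birth
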